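import Summits.HodgeConjecture.HodgeConjecture.Theses.CurveNetMordellWeil
import Literature.AlgebraicGeometry.HodgeTheory.ComplexConjugationHolds

/-!
# Route CurveNetMordellWeil — `HodgeModels` (support item stmt-HodgeConjecture-3050)

The support item `HodgeModels` of route `CurveNetMordellWeil` —
`∀ ⦃n⦄ ⦃X : SchemeOver ℂ⦄, IsSmoothProjective n X → Nonempty (HodgeModel n X)`, the verbatim
restatement of the Literature named fact `Literature.AlgebraicGeometry.HodgeTheory.nonempty_hodgeModel`
(every smooth projective complex variety of dimension `n` has a Hodge model: Serre's analytification,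
de Rham's theorem, the Hodge decomposition of the compact Kähler manifold `X^an`) — is the second
antecedent of this route's deciding theorem `closes` (it supplies the anti-vacuity conjunct of
`HodgeConjectureFor`).  The named fact is discharged in the Literature library by
`Literature.AlgebraicGeometry.HodgeTheory.nonempty_hodgeModel_holds`
(`HodgeTheory/ComplexConjugationHolds`, relying on nothing unproved), so the item closes in one line.
Self-contained: it imports only this route's thesis file (route files are never imported together).
-/

-- `Summit.HodgeConjecture.HodgeConjecture.Theorems` is the mandated namespace (single-problem summit:
-- Problem = Summit), which `linter.dupNamespace` flags on every declaration; the lakefile turns the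
-- linter off tree-wide (weak option), restated here so stand-alone elaboration is warning-free too.
set_option linter.dupNamespace false

noncomputable section

namespace Summit.HodgeConjecture.HodgeConjecture.Theorems

/-- **Item stmt-HodgeConjecture-3050 (`HodgeModels`), route `CurveNetMordellWeil`**: every smooth
projective complex variety has a Hodge model — `∀ n X, IsSmoothProjective n X → Nonempty (HodgeModel n X)`
— by the Literature discharge `nonempty_hodgeModel_holds` (Serre GAGA §2: analytification; de Rham;
Voisin (2002) §6.1.3 Prop. 6.11: Hodge decomposition of compact Kähler manifolds).  The type is
literally the route decl
`Summit.HodgeConjecture.HodgeConjecture.Theses.CurveNetMordellWeil.HodgeModels`.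
[cite: SerreGAGA1956, §2 n°5 Prop. 2 and n°7 Prop. 6]
[cite: VoisinHodgeI2002, §3.3.2 and §6.1.3 Prop. 6.11] -/
theorem curveNetMordellWeil_hodgeModels_proof :
    Summit.HodgeConjecture.HodgeConjecture.Theses.CurveNetMordellWeil.HodgeModels := by
  unfold Summit.HodgeConjecture.HodgeConjecture.Theses.CurveNetMordellWeil.HodgeModels
  exact fun n X ↦ Literature.AlgebraicGeometry.HodgeTheory.nonempty_hodgeModel_holds

end Summit.HodgeConjecture.HodgeConjecture.Theorems

end
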